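import Mathlib
import HarnessLib
import Summits.NavierStokesRegularity.NavierStokesRegularity.Theorems.PoloidalWindowDoorPoloidalWindowRigidityLocalVorticitySymmetry
import Summits.NavierStokesRegularity.NavierStokesRegularity.Theorems.PoloidalWindowDoorLrcModEntireTwistingTHPlaneOscillationLink

/-!
# Route `PoloidalWindowDoor`, item `LrcModEntire` (stmt-NavierStokesRegularity-20428), cell (Q4) of the (TH) column —
# THE HORIZONTAL GERM ENDGAME: a (TH) class profile whose vertical velocity at `t = −1` has a vanishing derivative
# along a horizontal direction on a slab is trivial (brick E1 of LEAD memo T2B-g16 §4/§6(iii))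

Cell ns-regularity-ideate, LEAD-lineage seat ns-poloidal-K2-p3 g16 (`--supports stmt-NavierStokesRegularity-20428`).

On a (TH) slab `{|x₂| < ρ}` of the slice `t = −1` (`∂₂v_b = μ(x₂)∂_b v₂`, `b = 0,1`) the vorticity of a poloidal field is
`ω = ((1−μ)∂₁v₂, −(1−μ)∂₀v₂, 0)` (tree `…TwistingTHPlaneOscillationLink.curl_eq_on_planeShear`).  Hence, if the derivative
of `v₂(−1,·)` along a horizontal direction `e ≠ 0` vanishes on the slab, so does the derivative of the vorticity along `e`
(`fderiv_curl_eq_zero_of_horizontalDeriv`: symmetry of second derivatives, `μ` constant along horizontal lines), which is a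
translation GERM of the vorticity on a nonempty open set of one slice; the tree's `curl_translate_of_fderiv_eq_zero_on` +
`eq_zero_of_curl_translate_eq_slice` (the road of `…LrcModEntireIff.eq_zero_of_germ`) then force `v ≡ 0` (`eq_zero_of_horizontalDeriv_two_eq_zero`), contradicting a non-zero hot value
(`false_of_horizontalDeriv_two_eq_zero`).  This is the endgame of the sub-cell `stub_Q4line` of (Q4): the memo's
Cauchy–Kovalevskaya step (`…SheetCauchyUniqueness.eq_zero_on_slab`) delivers exactly the hypothesis `∂_e v₂(−1,·) ≡ 0` on a
slab.

WHAT THIS IS NOT: not a claim about Navier–Stokes regularity; a Liouville-type brick for one sub-cell of one research cell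
(bears_on LADDER-NS N0 via item 20428; 20428/19708 OPEN).
-/

noncomputable section

set_option linter.dupNamespace false
set_option linter.unusedVariables false

namespace Summit.NavierStokesRegularity.NavierStokesRegularity.Theorems.PoloidalWindowDoorLrcModEntireHorizontalGerm

open Set Function Filter Topology Metric
open scoped RealInnerProductSpace InnerProductSpace ContDiff
open Literature.Analysis Literature.Analysis.FluidPDE
open Summit.NavierStokesRegularity.NavierStokesRegularity.Theorems.LocalSineTubeDoorProfileAlignedWindowRigidityAncient
open Summit.NavierStokesRegularity.NavierStokesRegularity.Theorems.PoloidalWindowDoorPoloidalWindowRigidityVorticityTranslate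
open Summit.NavierStokesRegularity.NavierStokesRegularity.Theorems.PoloidalWindowDoorPoloidalWindowRigidityLocalVorticitySymmetry
open Summit.NavierStokesRegularity.NavierStokesRegularity.Theorems.PoloidalWindowDoorLrcModEntireTwistingTHPlaneOscillationLink

variable {C : ℝ} {v : ℝ → EuclideanSpace ℝ (Fin 3) → EuclideanSpace ℝ (Fin 3)}

/-! ### Two calculus facts -/

/-- **If `∂_e θ` vanishes near `x`, every directional derivative `∂_u θ` has vanishing `e`-derivative at `x`**
(symmetry of the second derivative of a `C²` function). -/
theorem fderiv_fderiv_apply_eq_zero_of_eventually {θ : EuclideanSpace ℝ (Fin 3) → ℝ} {x : EuclideanSpace ℝ (Fin 3)}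
    (hθ : ContDiffAt ℝ 2 θ x) {e : EuclideanSpace ℝ (Fin 3)}
    (hη : (fun y => fderiv ℝ θ y e) =ᶠ[𝓝 x] fun _ => 0) (u : EuclideanSpace ℝ (Fin 3)) :
    fderiv ℝ (fun y => fderiv ℝ θ y u) x e = 0 := by
  have hD : DifferentiableAt ℝ (fderiv ℝ θ) x :=
    ((hθ.fderiv_right (m := 1) (by norm_num)).differentiableAt (by norm_num))
  have h1 : fderiv ℝ (fun y => fderiv ℝ θ y u) x e = fderiv ℝ (fderiv ℝ θ) x e u := by
    rw [fderiv_clm_apply hD (differentiableAt_const u)]; simp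
  have h2 : fderiv ℝ (fun y => fderiv ℝ θ y e) x u = fderiv ℝ (fderiv ℝ θ) x u e := by
    rw [fderiv_clm_apply hD (differentiableAt_const e)]; simp
  have hsymm : fderiv ℝ (fderiv ℝ θ) x e u = fderiv ℝ (fderiv ℝ θ) x u e :=
    hθ.isSymmSndFDerivAt (by simp) e u
  have h0 : fderiv ℝ (fun y => fderiv ℝ θ y e) x u = 0 := by
    rw [hη.fderiv_eq]; simp
  rw [h1, hsymm, ← h2, h0]

section Class

variable (hrate : HasTypeITimeDecay C v)
  (hcont : ContinuousOn (uncurry v) (Iio (0 : ℝ) ×ˢ univ))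
  (hmild : ∀ s t : ℝ, s < t → t < 0 → ∀ x,
    v t x = UnboundedOperators.heatExtension (v s) (t - s) x - oseenDuhamel 1 s v v t x)
  (hdiv : ∀ t < 0, VectorCalculus.IsDivFree (v t))
  (hpol : ∀ s < 0, ∀ y, ⟪curl (v s) y, EuclideanSpace.single 2 1⟫_ℝ = 0)

include hrate hcont hmild

/-- **The vorticity has a vanishing `e`-derivative on a (TH) slab where `∂_e v₂(−1,·)` vanishes.**  If on the slab
`{|x₂| < ρ}` of the slice `t = −1` the shear is proportional with height-only slope (`∂₂v_b = μ(x₂)∂_b v₂`, `b = 0,1`), the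
slice is poloidal, and the derivative of `v₂(−1,·)` along a horizontal `e` vanishes there, then `D(curl v(−1))(x)[e] = 0` on
the slab. -/
theorem fderiv_curl_eq_zero_of_horizontalDeriv
    (hpol1 : ∀ y, ⟪curl (v (-1)) y, EuclideanSpace.single 2 1⟫_ℝ = 0)
    {μ : ℝ → ℝ} {ρ : ℝ}
    (hslope : ∀ x : EuclideanSpace ℝ (Fin 3), |x 2| < ρ → ∀ b : Fin 3, b ≠ 2 →
      fderiv ℝ (v (-1)) x (EuclideanSpace.single 2 1) b = μ (x 2) * fderiv ℝ (v (-1)) x (EuclideanSpace.single b 1) 2)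
    {e : EuclideanSpace ℝ (Fin 3)} (he2 : e 2 = 0)
    (hη : ∀ x : EuclideanSpace ℝ (Fin 3), |x 2| < ρ → fderiv ℝ (fun y => v (-1) y 2) x e = 0)
    {x : EuclideanSpace ℝ (Fin 3)} (hx : |x 2| < ρ) : fderiv ℝ (curl (v (-1))) x e = 0 := by
  have hs : (-1 : ℝ) < 0 := by norm_num
  set θ : EuclideanSpace ℝ (Fin 3) → ℝ := fun y => v (-1) y 2 with hθ
  -- analyticity / smoothness of the slice, of `θ`, and of the vorticity
  have hanV : AnalyticOnNhd ℝ (v (-1)) univ := analyticOnNhd_slice hcont (bdd_of_hasTypeITimeDecay hrate) hmild hs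
  have hVd : Differentiable ℝ (v (-1)) := fun y => (hanV y (mem_univ _)).differentiableAt
  have hanθ : AnalyticOnNhd ℝ θ univ := fun y _ =>
    ((EuclideanSpace.proj (2 : Fin 3) : EuclideanSpace ℝ (Fin 3) →L[ℝ] ℝ).analyticAt _).comp (hanV y (mem_univ _))
  have hθ2 : ∀ y, ContDiffAt ℝ 2 θ y := fun y => (hanθ y (mem_univ _)).contDiffAt.of_le le_top
  have hanΩ : AnalyticOnNhd ℝ (curl (v (-1))) univ := by
    rw [curl_eq_curlCLM_comp]; exact curlCLM.comp_analyticOnNhd hanV.fderiv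
  have hΩd : Differentiable ℝ (curl (v (-1))) := fun y => (hanΩ y (mem_univ _)).differentiableAt
  -- coordinates of a Fréchet derivative
  have hcoord : ∀ {w : EuclideanSpace ℝ (Fin 3) → EuclideanSpace ℝ (Fin 3)} {y : EuclideanSpace ℝ (Fin 3)},
      DifferentiableAt ℝ w y → ∀ (i : Fin 3) (u : EuclideanSpace ℝ (Fin 3)), fderiv ℝ (fun y' => w y' i) y u = (fderiv ℝ w y u) i := by
    intro w y hw i u
    have h := ((EuclideanSpace.proj i : EuclideanSpace ℝ (Fin 3) →L[ℝ] ℝ).hasFDerivAt.comp y hw.hasFDerivAt)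
    rw [show (fun y' => w y' i) = (EuclideanSpace.proj i : EuclideanSpace ℝ (Fin 3) →L[ℝ] ℝ) ∘ w from rfl, h.fderiv]
    rfl
  -- the open slab
  have hopen : IsOpen {y : EuclideanSpace ℝ (Fin 3) | |y 2| < ρ} :=
    isOpen_lt (continuous_abs.comp (EuclideanSpace.proj (2 : Fin 3)).continuous) continuous_const
  -- `∂_e θ ≡ 0` near every point of the slab, hence `∂_e(∂_u θ) = 0` there
  have hη_ev : ∀ {y : EuclideanSpace ℝ (Fin 3)}, |y 2| < ρ → (fun y' => fderiv ℝ θ y' e) =ᶠ[𝓝 y] fun _ => 0 := by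
    intro y hy
    filter_upwards [hopen.mem_nhds hy] with y' hy'
    exact hη y' hy'
  have hmix : ∀ {y : EuclideanSpace ℝ (Fin 3)}, |y 2| < ρ → ∀ u : EuclideanSpace ℝ (Fin 3),
      fderiv ℝ (fun y' => fderiv ℝ θ y' u) y e = 0 := fun hy u =>
    fderiv_fderiv_apply_eq_zero_of_eventually (hθ2 _) (hη_ev hy) u
  -- the vorticity on the slab: `ω = ((1−μ)∂₁θ, −(1−μ)∂₀θ, 0)`
  have hpol' : ∀ y : EuclideanSpace ℝ (Fin 3), curl (v (-1)) y 2 = 0 := fun y => by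
    have h := hpol1 y
    rw [EuclideanSpace.inner_single_right] at h
    simpa using h
  have hcurl : ∀ y : EuclideanSpace ℝ (Fin 3), |y 2| < ρ →
      curl (v (-1)) y 0 = (1 - μ (y 2)) * fderiv ℝ θ y (EuclideanSpace.single 1 1) ∧
      curl (v (-1)) y 1 = -(1 - μ (y 2)) * fderiv ℝ θ y (EuclideanSpace.single 0 1) ∧
      curl (v (-1)) y 2 = 0 := by
    intro y hy
    have hsl : ∀ y' : EuclideanSpace ℝ (Fin 3), y' 2 = y 2 → ∀ b : Fin 3, b ≠ 2 →
        fderiv ℝ (v (-1)) y' (EuclideanSpace.single 2 1) b = μ (y 2) * fderiv ℝ (v (-1)) y' (EuclideanSpace.single b 1) 2 := by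
      intro y' hy' b hb
      have h := hslope y' (by rw [hy']; exact hy) b hb
      rwa [hy'] at h
    have hpl : ∀ y' : EuclideanSpace ℝ (Fin 3), y' 2 = y 2 → curl (v (-1)) y' 2 = 0 := fun y' _ => hpol' y'
    obtain ⟨h0, h1, h2⟩ := curl_eq_on_planeShear (V := v (-1)) (c := y 2) (μ := μ (y 2)) hsl hpl (y := y) rfl
    refine ⟨?_, ?_, h2⟩
    · rw [h0, hθ, hcoord (hVd y) 2]
    · rw [h1, hθ, hcoord (hVd y) 2]
  -- along the horizontal line `x + l e` the height is constant
  have hline2 : ∀ l : ℝ, (x + l • e) 2 = x 2 := fun l => by simp [he2]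
  have hlineIn : ∀ l : ℝ, |(x + l • e) 2| < ρ := fun l => by rw [hline2]; exact hx
  -- the `e`-derivative of a function along the line, as a derivative in `l`
  have hderiv_line : ∀ {g : EuclideanSpace ℝ (Fin 3) → ℝ}, DifferentiableAt ℝ g x →
      fderiv ℝ g x e = deriv (fun l : ℝ => g (x + l • e)) 0 := by
    intro g hg
    have h1 : HasFDerivAt g (fderiv ℝ g x) (x + (0 : ℝ) • e) := by simpa using hg.hasFDerivAt
    have h2 : HasDerivAt (fun l : ℝ => x + l • e) e 0 := by
      simpa using ((hasDerivAt_id (0 : ℝ)).smul_const e).const_add x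
    exact (h1.comp_hasDerivAt 0 h2).deriv.symm
  -- componentwise computation of `D(curl v(−1))(x)[e]`
  have hgi : ∀ i : Fin 3, DifferentiableAt ℝ (fun y => curl (v (-1)) y i) x := fun i =>
    (((EuclideanSpace.proj i : EuclideanSpace ℝ (Fin 3) →L[ℝ] ℝ).differentiableAt).comp x (hΩd x))
  have hDθ : DifferentiableAt ℝ (fderiv ℝ θ) x :=
    (((hθ2 x).fderiv_right (m := 1) (by norm_num)).differentiableAt (by norm_num))
  have hcomp0 : (fderiv ℝ (curl (v (-1))) x e) 0 = 0 := by
    rw [← hcoord (hΩd x) 0, hderiv_line (hgi 0)]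
    have hfun : (fun l : ℝ => curl (v (-1)) (x + l • e) 0) =
        fun l => (1 - μ (x 2)) * fderiv ℝ θ (x + l • e) (EuclideanSpace.single 1 1) := by
      funext l
      rw [(hcurl _ (hlineIn l)).1, hline2]
    have hg : DifferentiableAt ℝ (fun y => fderiv ℝ θ y (EuclideanSpace.single 1 1)) x :=
      hDθ.clm_apply (differentiableAt_const _)
    rw [hfun, deriv_const_mul_field, ← hderiv_line hg, hmix hx]
    simp
  have hcomp1 : (fderiv ℝ (curl (v (-1))) x e) 1 = 0 := by
    rw [← hcoord (hΩd x) 1, hderiv_line (hgi 1)]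
    have hfun : (fun l : ℝ => curl (v (-1)) (x + l • e) 1) =
        fun l => -(1 - μ (x 2)) * fderiv ℝ θ (x + l • e) (EuclideanSpace.single 0 1) := by
      funext l
      rw [(hcurl _ (hlineIn l)).2.1, hline2]
    have hg : DifferentiableAt ℝ (fun y => fderiv ℝ θ y (EuclideanSpace.single 0 1)) x :=
      hDθ.clm_apply (differentiableAt_const _)
    rw [hfun, deriv_const_mul_field, ← hderiv_line hg, hmix hx]
    simp
  have hcomp2 : (fderiv ℝ (curl (v (-1))) x e) 2 = 0 := by
    rw [← hcoord (hΩd x) 2, hderiv_line (hgi 2)]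
    have hfun : (fun l : ℝ => curl (v (-1)) (x + l • e) 2) = fun _ => 0 := by
      funext l; exact (hcurl _ (hlineIn l)).2.2
    rw [hfun, deriv_const]
  ext i
  fin_cases i
  · simpa using hcomp0
  · simpa using hcomp1
  · simpa using hcomp2

include hdiv hpol

/-- **A (TH) class profile with `∂_e v₂(−1,·) ≡ 0` on a slab is trivial** (`e` horizontal, `e ≠ 0`): the vorticity has a
translation germ on the open slab, and the tree's vorticity-translation Liouville theorem ends. -/
theorem eq_zero_of_horizontalDeriv_two_eq_zero {μ : ℝ → ℝ} {ρ : ℝ} (hρ : 0 < ρ)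
    (hslope : ∀ x : EuclideanSpace ℝ (Fin 3), |x 2| < ρ → ∀ b : Fin 3, b ≠ 2 →
      fderiv ℝ (v (-1)) x (EuclideanSpace.single 2 1) b = μ (x 2) * fderiv ℝ (v (-1)) x (EuclideanSpace.single b 1) 2)
    {e : EuclideanSpace ℝ (Fin 3)} (he : e ≠ 0) (he2 : e 2 = 0)
    (hη : ∀ x : EuclideanSpace ℝ (Fin 3), |x 2| < ρ → fderiv ℝ (fun y => v (-1) y 2) x e = 0) :
    ∀ t < 0, ∀ x, v t x = 0 := by
  have hs : (-1 : ℝ) < 0 := by norm_num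
  have hopen : IsOpen {y : EuclideanSpace ℝ (Fin 3) | |y 2| < ρ} :=
    isOpen_lt (continuous_abs.comp (EuclideanSpace.proj (2 : Fin 3)).continuous) continuous_const
  have hne : ({y : EuclideanSpace ℝ (Fin 3) | |y 2| < ρ}).Nonempty := ⟨0, by simpa using hρ⟩
  have hgerm : ∀ y ∈ {y : EuclideanSpace ℝ (Fin 3) | |y 2| < ρ}, fderiv ℝ (curl (v (-1))) y e = 0 := fun y hy =>
    fderiv_curl_eq_zero_of_horizontalDeriv hrate hcont hmild (hpol (-1) hs) hslope he2 hη hy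
  exact eq_zero_of_curl_translate_eq_slice hrate hcont hmild hdiv hs he
    (curl_translate_of_fderiv_eq_zero_on hrate hcont hmild hs hopen hne hgerm)

/-- **The endgame of `stub_Q4line`** (memo T2B-g16 §4): with a non-zero hot value `v₂(−1,0) ≠ 0` the hypotheses of
`eq_zero_of_horizontalDeriv_two_eq_zero` are contradictory. -/
theorem false_of_horizontalDeriv_two_eq_zero {μ : ℝ → ℝ} {ρ : ℝ} (hρ : 0 < ρ)
    (hslope : ∀ x : EuclideanSpace ℝ (Fin 3), |x 2| < ρ → ∀ b : Fin 3, b ≠ 2 →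
      fderiv ℝ (v (-1)) x (EuclideanSpace.single 2 1) b = μ (x 2) * fderiv ℝ (v (-1)) x (EuclideanSpace.single b 1) 2)
    {e : EuclideanSpace ℝ (Fin 3)} (he : e ≠ 0) (he2 : e 2 = 0)
    (hη : ∀ x : EuclideanSpace ℝ (Fin 3), |x 2| < ρ → fderiv ℝ (fun y => v (-1) y 2) x e = 0)
    (hN : v (-1) 0 2 ≠ 0) : False :=
  hN (by rw [eq_zero_of_horizontalDeriv_two_eq_zero hrate hcont hmild hdiv hpol hρ hslope he he2 hη (-1) (by norm_num) 0]; rfl)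

end Class

/-! ### Local germ (appended by ns-k2-port-2 g7): `∂_e v₂(−1,·) = 0` on SOME nonempty open set suffices -/

section LocalGerm

variable (hrate : HasTypeITimeDecay C v)
  (hcont : ContinuousOn (uncurry v) (Iio (0 : ℝ) ×ˢ univ))
  (hmild : ∀ s t : ℝ, s < t → t < 0 → ∀ x,
    v t x = UnboundedOperators.heatExtension (v s) (t - s) x - oseenDuhamel 1 s v v t x)

include hrate hcont hmild

/-- **The germ spreads (real-analyticity of the slice):** if `D(v₂(−1,·))(x)[e] = 0` on a nonempty open set `V`, then it vanishes at every
`x ∈ ℝ³` — in particular on the whole slab.  (What Cauchy–Kovalevskaya uniqueness across the sheet delivers is a NEIGHBOURHOOD of one sheet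
point; this is the bridge to the slab hypothesis `hη` of `eq_zero_of_horizontalDeriv_two_eq_zero`.) -/
theorem horizontalDeriv_two_eq_zero_of_local {e : EuclideanSpace ℝ (Fin 3)} {V : Set (EuclideanSpace ℝ (Fin 3))} (hV : IsOpen V)
    (hVne : V.Nonempty) (hη : ∀ x ∈ V, fderiv ℝ (fun y => v (-1) y 2) x e = 0) :
    ∀ x : EuclideanSpace ℝ (Fin 3), fderiv ℝ (fun y => v (-1) y 2) x e = 0 := by
  have hs : (-1 : ℝ) < 0 := by norm_num
  have hanV : AnalyticOnNhd ℝ (v (-1)) univ := analyticOnNhd_slice hcont (bdd_of_hasTypeITimeDecay hrate) hmild hs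
  have hanθ : AnalyticOnNhd ℝ (fun y => v (-1) y 2) univ := fun y _ =>
    ((EuclideanSpace.proj (2 : Fin 3) : EuclideanSpace ℝ (Fin 3) →L[ℝ] ℝ).analyticAt _).comp (hanV y (mem_univ _))
  have hgan : AnalyticOnNhd ℝ (fun x => fderiv ℝ (fun y => v (-1) y 2) x e) univ :=
    (ContinuousLinearMap.apply ℝ ℝ e).comp_analyticOnNhd hanθ.fderiv
  obtain ⟨x₀, hx₀⟩ := hVne
  have hev : (fun x => fderiv ℝ (fun y => v (-1) y 2) x e) =ᶠ[𝓝 x₀] 0 := by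
    filter_upwards [hV.mem_nhds hx₀] with x hx
    exact hη x hx
  exact fun x => hgan.eqOn_zero_of_preconnected_of_eventuallyEq_zero isPreconnected_univ (mem_univ x₀) hev (mem_univ x)

variable (hdiv : ∀ t < 0, VectorCalculus.IsDivFree (v t))
  (hpol : ∀ s < 0, ∀ y, ⟪curl (v s) y, EuclideanSpace.single 2 1⟫_ℝ = 0)

include hdiv hpol

/-- **The endgame of `stub_Q4line` from a LOCAL germ**: (TH) slope form on the slab `{|x₂| < ρ}` (`ρ > 0`), `e` horizontal, `e ≠ 0`,
`D(v₂(−1,·))[e] = 0` on SOME nonempty open set, hot value `v₂(−1,0) ≠ 0` ⇒ `False`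
(`horizontalDeriv_two_eq_zero_of_local` + `false_of_horizontalDeriv_two_eq_zero`). -/
theorem false_of_local_horizontalDeriv_two_eq_zero {μ : ℝ → ℝ} {ρ : ℝ} (hρ : 0 < ρ)
    (hslope : ∀ x : EuclideanSpace ℝ (Fin 3), |x 2| < ρ → ∀ b : Fin 3, b ≠ 2 →
      fderiv ℝ (v (-1)) x (EuclideanSpace.single 2 1) b = μ (x 2) * fderiv ℝ (v (-1)) x (EuclideanSpace.single b 1) 2)
    {e : EuclideanSpace ℝ (Fin 3)} (he : e ≠ 0) (he2 : e 2 = 0)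
    {V : Set (EuclideanSpace ℝ (Fin 3))} (hV : IsOpen V) (hVne : V.Nonempty)
    (hη : ∀ x ∈ V, fderiv ℝ (fun y => v (-1) y 2) x e = 0) (hN : v (-1) 0 2 ≠ 0) : False :=
  false_of_horizontalDeriv_two_eq_zero hrate hcont hmild hdiv hpol hρ hslope he he2
    (fun x _ => horizontalDeriv_two_eq_zero_of_local hrate hcont hmild hV hVne hη x) hN

/-- **Binder currency** (registered `stub_Q4` U-package, twist_split v8): the slab slope form VERBATIM `∀ t, |t + 1| < ρ → ∀ x, |x 2| < ρ → ∀ b ≠ 2,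
∂₂U_b(t,x) = m t (x 2)·∂_bU₂(t,x)` (`m : ℝ → ℝ → ℝ`), the local germ, and the hot value. -/
theorem false_of_local_horizontalDeriv_two_eq_zero_slab {m : ℝ → ℝ → ℝ} {ρ : ℝ} (hρ : 0 < ρ)
    (hslabU : ∀ t : ℝ, |t + 1| < ρ → ∀ x : EuclideanSpace ℝ (Fin 3), |x 2| < ρ → ∀ b : Fin 3, b ≠ 2 →
      fderiv ℝ (v t) x (EuclideanSpace.single 2 1) b = m t (x 2) * fderiv ℝ (v t) x (EuclideanSpace.single b 1) 2)
    {e : EuclideanSpace ℝ (Fin 3)} (he : e ≠ 0) (he2 : e 2 = 0)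
    {V : Set (EuclideanSpace ℝ (Fin 3))} (hV : IsOpen V) (hVne : V.Nonempty)
    (hη : ∀ x ∈ V, fderiv ℝ (fun y => v (-1) y 2) x e = 0) (hN : v (-1) 0 2 ≠ 0) : False :=
  false_of_local_horizontalDeriv_two_eq_zero hrate hcont hmild hdiv hpol hρ (μ := m (-1))
    (fun x hx b hb => hslabU (-1) (by simpa using hρ) x hx b hb) he he2 hV hVne hη hN

end LocalGerm

end Summit.NavierStokesRegularity.NavierStokesRegularity.Theorems.PoloidalWindowDoorLrcModEntireHorizontalGerm
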